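import Summits.BirchSwinnertonDyer.BirchSwinnertonDyer.Theorems.PrintCFramBottomClassIndexLawFiveLeParitySplitPrimitivityBindersOffLocus
import Summits.BirchSwinnertonDyer.BirchSwinnertonDyer.Theorems.PrintCFramBottomClassIndexLawFiveLeEisensteinEndStateV19Primitivity
import Summits.BirchSwinnertonDyer.BirchSwinnertonDyer.Theorems.PrintCFramBottomClassIndexLawFiveLeEisensteinEndStateV19Binders
import Summits.BirchSwinnertonDyer.BirchSwinnertonDyer.Theorems.PrintCFramBottomClassIndexLawFiveLeKrizLiLocusOfPrintsFour
import HarnessLib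

/-!
# Crux `PrintCFram.BottomClassIndexLawFiveLe` (stmt-BirchSwinnertonDyer-20372), line `eisenstein-resource-bdp-line`, registry v19 (v20 «elementary
# currency» announced by LEAD g12): THE KOLYVAGIN READING WITH BOTH NEW HYPOTHESES ON B1's OWN LOCUS — on the regular locus `BSD_p` is print +
# Kriz–Li + Stub C; B1 ⟺ B1-sha ∧ B1-prim|_{B1} (mod C♭|_{B1}, MAZUR–WILES-FREE); END STATE crux ⟸ prints4 ∧ KL ∧ C ∧ C♭|_{B1} ∧ B1-sha ∧ B1-prim|_{B1};
# and v20's hardest stub B1-level ⟸ B1-sha ∧ B1-prim|_{B1} ∧ C♭|_{B1}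

Cell `bsd-print-cfram`, width seat `bsd-line-cfram-p1-w3` g10, `--supports stmt-BirchSwinnertonDyer-20372` (helper). THEOREMS ONLY; no
definition, no named fact, no `sorry`. BSD is not proved by any of this; no summit statement is proved by this seat; no stub is closed; the
crux stays OPEN and is NOT claimed false. Sequel of `…EisensteinEndStateV19Primitivity` (character-free texts B1-prim / C♭_Ш) and
`…ParitySplitPrimitivityBindersOffLocus` (the same two texts restricted to B1's binders: odd datum `(f, ψ, ω)`, trace congruence, NON-unit class factor
`‖B_{1,ψ⁻¹}‖_p ≤ p⁻¹` — «B1-prim|_{B1}», «C♭|_{B1}»). TEXTS as in those files; B1-sha / B1-level are LEAD g11's `hSha` / `hLevel` verbatim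
(`EisensteinEndStateV19Binders`), = registry v20's `stub_bsdp_of_sha` / `stub_bsdp_of_level`.

* §1 (both new hypotheses restricted to B1's OWN locus — odd datum, trace congruence, NON-unit class factor; `…ParitySplitPrimitivityBindersOffLocus`)
  `bsdp_of_prints4_of_krizLi_of_cover_of_unit_classFactor` (on the regular locus `BSD_p` is print + KL + C, pointwise),
  `heegnerIndex_of_heegnerIndexOffLocus_of_cover` (B1-prim ⟸ B1-prim|_{B1} mod prints4 ∧ KL ∧ C), `stubB1_iff_sha_and_heegnerIndexOffLocus`
  (**B1 ⟺ B1-sha ∧ B1-prim|_{B1} mod C♭|_{B1}**, Mazur–Wiles-free), and the END STATE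
  `bottomClassIndexLawFiveLe_of_prints4_of_krizLi_of_cover_of_twistSupplyOffLocus_of_sha_of_heegnerIndexOffLocus` (crux ⟸ prints4 ∧ KL ∧ C ∧ C♭|_{B1} ∧
  B1-sha ∧ B1-prim|_{B1}).

* §2 `level_of_sha_of_heegnerIndexOffLocus_of_twistSupplyOffLocus` — **B1-level ⟸ B1-sha ∧ B1-prim|_{B1} ∧ C♭|_{B1}** (MW-free, KL-free): what the
  Kolyvagin pair says about registry v20's hardest stub (LEAD g12) — through B1 (§1 of `…BindersOffLocus`) and w6 g3's (α)
  `EisensteinEndStateV19Currencies.bsdp_of_level_pos_of_stubB1`.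

References: crux workfiles `Lines/eisenstein_resource_bdp_line.lean` (v19), `Lines/eisenstein-resource-bdp-line-lead-g11.md` §5, `…-w3g9-notes.md` §2(c);
HOME STATUS LEAD g12 2026-08-28T23:39:14Z (v20 intent). CONDITIONAL on everything displayed.
-/

open scoped Classical Pointwise

set_option linter.dupNamespace false
set_option autoImplicit false

noncomputable section

namespace Summit.BirchSwinnertonDyer.BirchSwinnertonDyer.Theorems.PrintCFram.EisensteinEndStateV19Primitivity

open WeierstrassCurve NumberField
  Literature.NumberTheory.EllipticCurves
  Literature.NumberTheory.EllipticCurves.ModularForms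
  Literature.NumberTheory.EllipticCurves.Rank1Residual
  Literature.NumberTheory.EllipticCurves.Rank1Residual.Typed
  Literature.NumberTheory.EllipticCurves.KrizLi2019
  Summit.BirchSwinnertonDyer.Rank1Residual
  Summit.BirchSwinnertonDyer.Rank1Residual.X12
  Summit.BirchSwinnertonDyer.BirchSwinnertonDyer.Theses.UniversalToricDescent
  Summit.BirchSwinnertonDyer.BirchSwinnertonDyer.Theorems
  Summit.BirchSwinnertonDyer.BirchSwinnertonDyer.Theorems.PrintCFram

/-! ## §1 Both new hypotheses restricted to B1's own locus: the regular locus is print + Kriz–Li + Stub C -/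


/-- **On the REGULAR locus `BSD_p` is print + Kriz–Li + Stub C** (pointwise). For a class member `W` (CM, globally minimal, `CMRamified W p`, `p ≥ 5`,
`r_an(W) = 1`) and an odd datum `(f, ψ, ω)` with the trace congruence whose CLASS factor is a UNIT: Stub C (`hC`) hands an admissible Heegner `K''` with
unit FIELD factor, w3 g7's `OffLocusResidue.exists_characterData_of_unit_classFactor_of_unit_fieldFactor` turns the two units into the (KL) character data,
w6 g2's `KrizLiLValueFree.exists_krizLiDatum_iff_exists_characterData` into a Kriz–Li datum (Heegner point from `ToricPublishedInputs`, `L`-value from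
Thm. 1.20), and w7 g2's `KrizLiLocusOfPrintsFour.bsdp_cmRamified_of_krizLiDatum_of_prints4` — the (KL) branch of the registered composition — gives
`BSDp W p`. CONDITIONAL on prints4 ∧ KL ∧ C; BSD is not proved by any of this. [cite: KrizLi2019, Thm. 1.20 (pp. 7–8), Rem. 1.21 (p. 8)]
[cite: GrossZagier1986, I.§4 and Thm. I.(6.3)] [cite: BurungaleFlach2024, Thm. 1.1 and Cor. 2] -/
theorem bsdp_of_prints4_of_krizLi_of_cover_of_unit_classFactor
    (hprints4 :
    Hsieh2014.thmA_exists_isHsiehLFunction_unrPeriod_anyLevel ∧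
    LiuZhangZhang2018.thm151_thm153_modularCurve_heegnerVector_additive ∧
    Summit.BirchSwinnertonDyer.BirchSwinnertonDyer.Theses.UniversalToricDescent.ToricPublishedInputs ∧
    bsdTriple_of_hasCM_of_L_one_ne_zero)
    (hKL : thm120_padicLogHeegner_unit_of_bernoulli)
    (hC :
    ∀ (W : WeierstrassCurve ℚ) [W.IsElliptic] [W.IsGloballyMinimal] (p : ℕ) [Fact p.Prime],
      W.HasCM → CMRamified W p → 5 ≤ p → W.analyticRank = 1 →
      ∀ (f : ℕ) [NeZero f] (ψ : DirichletCharacter ℚ_[p] f) (ω : DirichletCharacter ℚ_[p] p),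
        ψ.Odd → IsTeichmullerCharacter ω →
        (∀ ℓ : ℕ, ℓ.Prime → ¬ (ℓ ∣ p * W.conductorNorm ℤ) →
          ‖((W.LFunction ℓ : ℤ) : ℚ_[p]) - (ψ (ℓ : ZMod f) + ψ⁻¹ (ℓ : ZMod f) * ω (ℓ : ZMod p))‖ < 1) →
        ¬ ‖bernoulliOnePrim ψ⁻¹‖ ≤ (p : ℝ)⁻¹ →
        ∃ (K : Type) (_ : Field K) (_ : NumberField K) (εK : DirichletCharacter ℚ_[p] (NumberField.discr K).natAbs),
          IsImaginaryQuadratic K ∧ SatisfiesHeegnerHypothesis (W.conductorNorm ℤ) K ∧ Odd (NumberField.discr K) ∧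
          NumberField.discr K < -4 ∧ IsKroneckerCharacterOf K εK ∧
          ¬ ‖bernoulliOnePrim (bernoulliCharTwo ψ εK ω)‖ ≤ (p : ℝ)⁻¹)
    (W : WeierstrassCurve ℚ) [W.IsElliptic] [W.IsGloballyMinimal] (p : ℕ) [Fact p.Prime]
    (hCM : W.HasCM) (hram : CMRamified W p) (h5 : 5 ≤ p) (hr : W.analyticRank = 1)
    {f : ℕ} [NeZero f] (ψ : DirichletCharacter ℚ_[p] f) (ω : DirichletCharacter ℚ_[p] p)
    (hψ : ψ.Odd) (hω : IsTeichmullerCharacter ω)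
    (hss : ∀ ℓ : ℕ, ℓ.Prime → ¬ (ℓ ∣ p * W.conductorNorm ℤ) →
      ‖((W.LFunction ℓ : ℤ) : ℚ_[p]) - (ψ (ℓ : ZMod f) + ψ⁻¹ (ℓ : ZMod f) * ω (ℓ : ZMod p))‖ < 1)
    (hcls : ¬ ‖bernoulliOnePrim ψ⁻¹‖ ≤ (p : ℝ)⁻¹) : BSDp W p := by
  obtain ⟨K, iK, iK', εK, hK, hHN, hoddK, hd4, hεK, hfld⟩ := hC W p hCM hram h5 hr f ψ ω hψ hω hss hcls
  have hCD := OffLocusResidue.exists_characterData_of_unit_classFactor_of_unit_fieldFactor W p hCM hram h5 ψ ω hψ hω hss hcls K hK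
    hHN hoddK hd4 εK hεK hfld
  exact KrizLiLocusOfPrintsFour.bsdp_cmRamified_of_krizLiDatum_of_prints4 hprints4 hKL W hCM hram h5 hr
    ((KrizLiLValueFree.exists_krizLiDatum_iff_exists_characterData hKL hprints4.2.2.1 W hCM hram h5 hr).mpr hCD)

/-- **B1-prim ⟸ B1-prim|_{B1}, modulo prints4 ∧ Kriz–Li ∧ Stub C.** The character-free primitivity statement (every rank-one member with `Ш(W)[p] = 0`,
every admissible Heegner datum with a `p`-regular minimal twist model) follows from its restriction to B1's locus (`hPrimB1`: odd datum, trace congruence,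
NON-unit class factor): take the class's odd Kriz–Li datum (`KrizLiBinders.exists_krizLiBinders_of_cmRamified`); on a unit class factor `BSD_p(W)` is
print + Kriz–Li + C (`bsdp_of_prints4_of_krizLi_of_cover_of_unit_classFactor`) and forces the identity (`ParitySplit.heegnerIndex_of_bsdp_cmRamified`);
otherwise `hPrimB1`. So the NEW content of B1-prim lives on the irregular members only. CONDITIONAL; BSD is not proved by any of this.
[cite: KrizLi2019, Thm. 1.20 (pp. 7–8)] [cite: GrossZagier1986, Thm. I.(6.3) and V.§2 (pp. 310–312)] [cite: BurungaleFlach2024, Thm. 1.1 and Cor. 2] -/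
theorem heegnerIndex_of_heegnerIndexOffLocus_of_cover
    (hprints4 :
    Hsieh2014.thmA_exists_isHsiehLFunction_unrPeriod_anyLevel ∧
    LiuZhangZhang2018.thm151_thm153_modularCurve_heegnerVector_additive ∧
    Summit.BirchSwinnertonDyer.BirchSwinnertonDyer.Theses.UniversalToricDescent.ToricPublishedInputs ∧
    bsdTriple_of_hasCM_of_L_one_ne_zero)
    (hKL : thm120_padicLogHeegner_unit_of_bernoulli)
    (hC :
    ∀ (W : WeierstrassCurve ℚ) [W.IsElliptic] [W.IsGloballyMinimal] (p : ℕ) [Fact p.Prime],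
      W.HasCM → CMRamified W p → 5 ≤ p → W.analyticRank = 1 →
      ∀ (f : ℕ) [NeZero f] (ψ : DirichletCharacter ℚ_[p] f) (ω : DirichletCharacter ℚ_[p] p),
        ψ.Odd → IsTeichmullerCharacter ω →
        (∀ ℓ : ℕ, ℓ.Prime → ¬ (ℓ ∣ p * W.conductorNorm ℤ) →
          ‖((W.LFunction ℓ : ℤ) : ℚ_[p]) - (ψ (ℓ : ZMod f) + ψ⁻¹ (ℓ : ZMod f) * ω (ℓ : ZMod p))‖ < 1) →
        ¬ ‖bernoulliOnePrim ψ⁻¹‖ ≤ (p : ℝ)⁻¹ →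
        ∃ (K : Type) (_ : Field K) (_ : NumberField K) (εK : DirichletCharacter ℚ_[p] (NumberField.discr K).natAbs),
          IsImaginaryQuadratic K ∧ SatisfiesHeegnerHypothesis (W.conductorNorm ℤ) K ∧ Odd (NumberField.discr K) ∧
          NumberField.discr K < -4 ∧ IsKroneckerCharacterOf K εK ∧
          ¬ ‖bernoulliOnePrim (bernoulliCharTwo ψ εK ω)‖ ≤ (p : ℝ)⁻¹)
    (hPrimB1 :
    ∀ (W : WeierstrassCurve ℚ) [W.IsElliptic] [W.IsGloballyMinimal] (p : ℕ) [Fact p.Prime],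
      W.HasCM → CMRamified W p → 5 ≤ p → W.analyticRank = 1 →
      ∀ (f : ℕ) [NeZero f] (ψ : DirichletCharacter ℚ_[p] f) (ω : DirichletCharacter ℚ_[p] p),
        ψ.Odd → IsTeichmullerCharacter ω →
        (∀ ℓ : ℕ, ℓ.Prime → ¬ (ℓ ∣ p * W.conductorNorm ℤ) →
          ‖((W.LFunction ℓ : ℤ) : ℚ_[p]) - (ψ (ℓ : ZMod f) + ψ⁻¹ (ℓ : ZMod f) * ω (ℓ : ZMod p))‖ < 1) →
        ‖bernoulliOnePrim ψ⁻¹‖ ≤ (p : ℝ)⁻¹ →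
        (∀ s ∈ W.sha, p • s = 0 → s = 0) →
        ∀ (N : ℕ) [NeZero N] (K : Type) [Field K] [NumberField K]
          (Dt : ModularParametrizationData W N) (H : HeegnerDatum N (NumberField.discr K)) (ι : K →+* ℂ)
          (P : (W.baseChange K).toAffine.Point) (Wd : WeierstrassCurve ℚ) [Wd.IsElliptic] [Wd.IsGloballyMinimal],
          W.conductorNorm ℤ = N → IsImaginaryQuadratic K → SatisfiesHeegnerHypothesis N K →
          Odd (NumberField.discr K) → NumberField.discr K < -4 →
          (W.quadraticTwist (NumberField.discr K : ℚ)).entireLFunction 1 ≠ 0 →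
          WeierstrassCurve.Affine.Point.map ι.toRatAlgHom P = heegnerPointComplex Dt H →
          (∃ C : VariableChange ℚ, C • W.quadraticTwist (NumberField.discr K : ℚ) = Wd) →
          (∀ s ∈ Wd.sha, p • s = 0 → s = 0) →
          padicValNat p (AddSubgroup.zmultiples P).index = padicValNat p Dt.c.natAbs) :
    ∀ (W : WeierstrassCurve ℚ) [W.IsElliptic] [W.IsGloballyMinimal] (p : ℕ) [Fact p.Prime],
      W.HasCM → CMRamified W p → 5 ≤ p → W.analyticRank = 1 →
      (∀ s ∈ W.sha, p • s = 0 → s = 0) →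
      ∀ (N : ℕ) [NeZero N] (K : Type) [Field K] [NumberField K]
        (Dt : ModularParametrizationData W N) (H : HeegnerDatum N (NumberField.discr K)) (ι : K →+* ℂ)
        (P : (W.baseChange K).toAffine.Point) (Wd : WeierstrassCurve ℚ) [Wd.IsElliptic] [Wd.IsGloballyMinimal],
        W.conductorNorm ℤ = N → IsImaginaryQuadratic K → SatisfiesHeegnerHypothesis N K →
        Odd (NumberField.discr K) → NumberField.discr K < -4 →
        (W.quadraticTwist (NumberField.discr K : ℚ)).entireLFunction 1 ≠ 0 →
        WeierstrassCurve.Affine.Point.map ι.toRatAlgHom P = heegnerPointComplex Dt H →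
        (∃ C : VariableChange ℚ, C • W.quadraticTwist (NumberField.discr K : ℚ) = Wd) →
        (∀ s ∈ Wd.sha, p • s = 0 → s = 0) →
        padicValNat p (AddSubgroup.zmultiples P).index = padicValNat p Dt.c.natAbs := by
  obtain ⟨hGZ, hKo, hGZK, hmod, -, -, hGZ73, -⟩ := hprints4.2.2.1
  intro W _ _ p _ hCM hram h5 hr h0 N _ K _ _ Dt H ι P Wd _ _ hN hK hHN hodd hd4 hLt hP hCWd h0d
  obtain ⟨f, hf, ψ, ω, -, hω, hss, -, -, hψ⟩ := KrizLiBinders.exists_krizLiBinders_of_cmRamified W hCM hram h5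
  haveI := hf
  by_cases hcls : ‖bernoulliOnePrim ψ⁻¹‖ ≤ (p : ℝ)⁻¹
  · exact hPrimB1 W p hCM hram h5 hr f ψ ω hψ hω hss hcls h0 N K Dt H ι P Wd hN hK hHN hodd hd4 hLt hP hCWd h0d
  · exact ParitySplit.heegnerIndex_of_bsdp_cmRamified hGZ hKo hGZK hmod hGZ73 hprints4.2.2.2 W hCM hram h5 hr
      (bsdp_of_prints4_of_krizLi_of_cover_of_unit_classFactor hprints4 hKL hC W p hCM hram h5 hr ψ ω hψ hω hss hcls) h0 N K Dt H ι P
      Wd hN hK hHN hodd hd4 hLt hP hCWd h0d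

/-- **B1 ⟺ B1-sha ∧ B1-prim|_{B1}, modulo the twist supply C♭|_{B1}** and the classical named facts Gross–Zagier I.(6.3), Kolyvagin, GZK, modularity,
Gross–Zagier I.(7.3), the Heegner-point supply, Burungale–Flach Cor. 2 — MAZUR–WILES-FREE and KRIZ–LI-FREE (contrast
`EisensteinEndStateV19Binders.stubB1_iff_stubB1Level_and_stubB1Sha`, whose ⟸ needs Mazur–Wiles Thm 2). (⟹) B1 ⟹ B1-sha is LEAD g11's
`EisensteinEndStateV19Binders.bsdp_of_sha_ne_zero_of_stubB1_of_GZK` (w6 g3's (α′): `Ш[p] ≠ 0` ⟹ irregular), B1 ⟹ B1-prim|_{B1} is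
`ParitySplit.heegnerIndexOffLocus_of_stubB1`; (⟸) `ParitySplit.stubB1_of_sha_of_heegnerIndexOffLocus_of_twistSupplyOffLocus`. The Kolyvagin reading: **the
line's arithmetic residue B1 is EXACTLY «`BSD_p` on the rank-one CM-ramified members with `Ш[p] ≠ 0`» ∧ «Heegner `p`-primitivity up to the Manin-type
constant on the Eisenstein-irregular rank-one members with `Ш[p] = 0`», granted one admissible `p`-regular twist per such member.** CONDITIONAL; BSD is not
proved by any of this. [cite: GrossZagier1986, I.§4, Thm. I.(6.3) and V.§2 (pp. 310–312)] [cite: Kolyvagin1990, Thm. A] [cite: BurungaleFlach2024, Thm. 1.1 and Cor. 2]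
[cite: KrizLi2019, Thm. 1.20 (pp. 7–8), (29) (pp. 49–50)] -/
theorem stubB1_iff_sha_and_heegnerIndexOffLocus
    (hGZ : ∀ (N : ℕ) [NeZero N] (W : WeierstrassCurve ℚ) (K : Type) [Field K] [NumberField K], gross_zagier N W K)
    (hKo : ∀ (N : ℕ) [NeZero N] (W : WeierstrassCurve ℚ) (K : Type) [Field K] [NumberField K], kolyvagin N W K)
    (hGZK : rank_eq_analyticRank_of_analyticRank_le_one) (hmod : hasEntireLFunction_rat) (hGZ73 : GrossZagier1986_thm_I_7_3)
    (hHP : ∀ (W : WeierstrassCurve ℚ) (K : Type) [Field K] [NumberField K], exists_isHeegnerPoint W K)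
    (hBF : bsdTriple_of_hasCM_of_L_one_ne_zero)
    (hSupB1 :
    ∀ (W : WeierstrassCurve ℚ) [W.IsElliptic] [W.IsGloballyMinimal] (p : ℕ) [Fact p.Prime],
      W.HasCM → CMRamified W p → 5 ≤ p → W.analyticRank = 1 →
      ∀ (f : ℕ) [NeZero f] (ψ : DirichletCharacter ℚ_[p] f) (ω : DirichletCharacter ℚ_[p] p),
        ψ.Odd → IsTeichmullerCharacter ω →
        (∀ ℓ : ℕ, ℓ.Prime → ¬ (ℓ ∣ p * W.conductorNorm ℤ) →
          ‖((W.LFunction ℓ : ℤ) : ℚ_[p]) - (ψ (ℓ : ZMod f) + ψ⁻¹ (ℓ : ZMod f) * ω (ℓ : ZMod p))‖ < 1) →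
        ‖bernoulliOnePrim ψ⁻¹‖ ≤ (p : ℝ)⁻¹ →
        (∀ s ∈ W.sha, p • s = 0 → s = 0) →
        ∃ (K : Type) (_ : Field K) (_ : NumberField K),
          IsImaginaryQuadratic K ∧ SatisfiesHeegnerHypothesis (W.conductorNorm ℤ) K ∧ Odd (NumberField.discr K) ∧
          NumberField.discr K < -4 ∧ (W.quadraticTwist (NumberField.discr K : ℚ)).entireLFunction 1 ≠ 0 ∧
          ∃ (Wd : WeierstrassCurve ℚ) (_ : Wd.IsElliptic) (_ : Wd.IsGloballyMinimal),
            (∃ C : VariableChange ℚ, C • W.quadraticTwist (NumberField.discr K : ℚ) = Wd) ∧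
            ∀ s ∈ Wd.sha, p • s = 0 → s = 0) :
    (∀ (W : WeierstrassCurve ℚ) [W.IsElliptic] [W.IsGloballyMinimal] (p : ℕ) [Fact p.Prime],
      W.HasCM → CMRamified W p → 5 ≤ p → W.analyticRank = 1 →
      ∀ (f : ℕ) [NeZero f] (ψ : DirichletCharacter ℚ_[p] f) (ω : DirichletCharacter ℚ_[p] p),
        ψ.Odd → IsTeichmullerCharacter ω →
        (∀ ℓ : ℕ, ℓ.Prime → ¬ (ℓ ∣ p * W.conductorNorm ℤ) →
          ‖((W.LFunction ℓ : ℤ) : ℚ_[p]) - (ψ (ℓ : ZMod f) + ψ⁻¹ (ℓ : ZMod f) * ω (ℓ : ZMod p))‖ < 1) →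
        ‖bernoulliOnePrim ψ⁻¹‖ ≤ (p : ℝ)⁻¹ →
        BSDp W p) ↔
    ((∀ (W : WeierstrassCurve ℚ) [W.IsElliptic] [W.IsGloballyMinimal] (p : ℕ) [Fact p.Prime],
      W.HasCM → CMRamified W p → 5 ≤ p → W.analyticRank = 1 →
      (∃ s ∈ W.sha, s ≠ 0 ∧ p • s = 0) → BSDp W p) ∧
    (∀ (W : WeierstrassCurve ℚ) [W.IsElliptic] [W.IsGloballyMinimal] (p : ℕ) [Fact p.Prime],
      W.HasCM → CMRamified W p → 5 ≤ p → W.analyticRank = 1 →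
      ∀ (f : ℕ) [NeZero f] (ψ : DirichletCharacter ℚ_[p] f) (ω : DirichletCharacter ℚ_[p] p),
        ψ.Odd → IsTeichmullerCharacter ω →
        (∀ ℓ : ℕ, ℓ.Prime → ¬ (ℓ ∣ p * W.conductorNorm ℤ) →
          ‖((W.LFunction ℓ : ℤ) : ℚ_[p]) - (ψ (ℓ : ZMod f) + ψ⁻¹ (ℓ : ZMod f) * ω (ℓ : ZMod p))‖ < 1) →
        ‖bernoulliOnePrim ψ⁻¹‖ ≤ (p : ℝ)⁻¹ →
        (∀ s ∈ W.sha, p • s = 0 → s = 0) →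
        ∀ (N : ℕ) [NeZero N] (K : Type) [Field K] [NumberField K]
          (Dt : ModularParametrizationData W N) (H : HeegnerDatum N (NumberField.discr K)) (ι : K →+* ℂ)
          (P : (W.baseChange K).toAffine.Point) (Wd : WeierstrassCurve ℚ) [Wd.IsElliptic] [Wd.IsGloballyMinimal],
          W.conductorNorm ℤ = N → IsImaginaryQuadratic K → SatisfiesHeegnerHypothesis N K →
          Odd (NumberField.discr K) → NumberField.discr K < -4 →
          (W.quadraticTwist (NumberField.discr K : ℚ)).entireLFunction 1 ≠ 0 →
          WeierstrassCurve.Affine.Point.map ι.toRatAlgHom P = heegnerPointComplex Dt H →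
          (∃ C : VariableChange ℚ, C • W.quadraticTwist (NumberField.discr K : ℚ) = Wd) →
          (∀ s ∈ Wd.sha, p • s = 0 → s = 0) →
          padicValNat p (AddSubgroup.zmultiples P).index = padicValNat p Dt.c.natAbs)) := by
  constructor
  · intro hB1
    exact ⟨fun W _ _ p _ hCM hram h5 hr hsha ↦
        EisensteinEndStateV19Binders.bsdp_of_sha_ne_zero_of_stubB1_of_GZK hGZK hB1 W p hCM hram h5 hr hsha,
      ParitySplit.heegnerIndexOffLocus_of_stubB1 hGZ hKo hGZK hmod hGZ73 hBF hB1⟩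
  · rintro ⟨hSha, hPrimB1⟩
    exact ParitySplit.stubB1_of_sha_of_heegnerIndexOffLocus_of_twistSupplyOffLocus hGZ hKo hGZK hmod hGZ73 hHP hBF hSha hPrimB1 hSupB1

/-- **END STATE v19 WITH THE NEW HYPOTHESES ON B1's LOCUS ONLY.** The crux follows from prints4 (`hprints4`), Kriz–Li Thm. 1.20 (`hKL`), registry
v19's Stub C (`hC`, GL(1): an admissible Heegner field with unit field factor for every REGULAR rank-one member), the twist supply **C♭|_{B1}** (`hSupB1`:
an admissible Heegner field with `L(W^{(d)},1) ≠ 0` and a `p`-regular twist for every IRREGULAR rank-one member with `Ш(W)[p] = 0` — «C♭ on B1's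
locus», w3 g9 notes §2(c)), **B1-sha** (`hSha`) and **B1-prim|_{B1}** (`hPrimB1`: Kolyvagin `p`-primitivity on the irregular members with `Ш(W)[p] = 0`).
Proof: `ParitySplit.stubB1_of_sha_of_heegnerIndexOffLocus_of_twistSupplyOffLocus` gives B1, then END STATE v19 (p673416). NO Mazur–Wiles. CONDITIONAL on
everything displayed; BSD is not proved by any of this; the crux stays OPEN.
[cite: KrizLi2019, Thm. 1.20 (pp. 7–8), §8 (pp. 49–52)] [cite: GrossZagier1986, I.§4, Thm. I.(6.3) and V.§2 (pp. 310–312)] [cite: Kolyvagin1990, Thm. A]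
[cite: BurungaleFlach2024, Thm. 1.1 and Cor. 2] [cite: BurungaleKobayashiNakamuraOta2026, §1.4 (arXiv:2608.06879 p. 8)] -/
theorem bottomClassIndexLawFiveLe_of_prints4_of_krizLi_of_cover_of_twistSupplyOffLocus_of_sha_of_heegnerIndexOffLocus
    (hprints4 :
    Hsieh2014.thmA_exists_isHsiehLFunction_unrPeriod_anyLevel ∧
    LiuZhangZhang2018.thm151_thm153_modularCurve_heegnerVector_additive ∧
    Summit.BirchSwinnertonDyer.BirchSwinnertonDyer.Theses.UniversalToricDescent.ToricPublishedInputs ∧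
    bsdTriple_of_hasCM_of_L_one_ne_zero)
    (hKL : thm120_padicLogHeegner_unit_of_bernoulli)
    (hC :
    ∀ (W : WeierstrassCurve ℚ) [W.IsElliptic] [W.IsGloballyMinimal] (p : ℕ) [Fact p.Prime],
      W.HasCM → CMRamified W p → 5 ≤ p → W.analyticRank = 1 →
      ∀ (f : ℕ) [NeZero f] (ψ : DirichletCharacter ℚ_[p] f) (ω : DirichletCharacter ℚ_[p] p),
        ψ.Odd → IsTeichmullerCharacter ω →
        (∀ ℓ : ℕ, ℓ.Prime → ¬ (ℓ ∣ p * W.conductorNorm ℤ) →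
          ‖((W.LFunction ℓ : ℤ) : ℚ_[p]) - (ψ (ℓ : ZMod f) + ψ⁻¹ (ℓ : ZMod f) * ω (ℓ : ZMod p))‖ < 1) →
        ¬ ‖bernoulliOnePrim ψ⁻¹‖ ≤ (p : ℝ)⁻¹ →
        ∃ (K : Type) (_ : Field K) (_ : NumberField K) (εK : DirichletCharacter ℚ_[p] (NumberField.discr K).natAbs),
          IsImaginaryQuadratic K ∧ SatisfiesHeegnerHypothesis (W.conductorNorm ℤ) K ∧ Odd (NumberField.discr K) ∧
          NumberField.discr K < -4 ∧ IsKroneckerCharacterOf K εK ∧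
          ¬ ‖bernoulliOnePrim (bernoulliCharTwo ψ εK ω)‖ ≤ (p : ℝ)⁻¹)
    (hSupB1 :
    ∀ (W : WeierstrassCurve ℚ) [W.IsElliptic] [W.IsGloballyMinimal] (p : ℕ) [Fact p.Prime],
      W.HasCM → CMRamified W p → 5 ≤ p → W.analyticRank = 1 →
      ∀ (f : ℕ) [NeZero f] (ψ : DirichletCharacter ℚ_[p] f) (ω : DirichletCharacter ℚ_[p] p),
        ψ.Odd → IsTeichmullerCharacter ω →
        (∀ ℓ : ℕ, ℓ.Prime → ¬ (ℓ ∣ p * W.conductorNorm ℤ) →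
          ‖((W.LFunction ℓ : ℤ) : ℚ_[p]) - (ψ (ℓ : ZMod f) + ψ⁻¹ (ℓ : ZMod f) * ω (ℓ : ZMod p))‖ < 1) →
        ‖bernoulliOnePrim ψ⁻¹‖ ≤ (p : ℝ)⁻¹ →
        (∀ s ∈ W.sha, p • s = 0 → s = 0) →
        ∃ (K : Type) (_ : Field K) (_ : NumberField K),
          IsImaginaryQuadratic K ∧ SatisfiesHeegnerHypothesis (W.conductorNorm ℤ) K ∧ Odd (NumberField.discr K) ∧
          NumberField.discr K < -4 ∧ (W.quadraticTwist (NumberField.discr K : ℚ)).entireLFunction 1 ≠ 0 ∧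
          ∃ (Wd : WeierstrassCurve ℚ) (_ : Wd.IsElliptic) (_ : Wd.IsGloballyMinimal),
            (∃ C : VariableChange ℚ, C • W.quadraticTwist (NumberField.discr K : ℚ) = Wd) ∧
            ∀ s ∈ Wd.sha, p • s = 0 → s = 0)
    (hSha :
    ∀ (W : WeierstrassCurve ℚ) [W.IsElliptic] [W.IsGloballyMinimal] (p : ℕ) [Fact p.Prime],
      W.HasCM → CMRamified W p → 5 ≤ p → W.analyticRank = 1 →
      (∃ s ∈ W.sha, s ≠ 0 ∧ p • s = 0) → BSDp W p)
    (hPrimB1 :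
    ∀ (W : WeierstrassCurve ℚ) [W.IsElliptic] [W.IsGloballyMinimal] (p : ℕ) [Fact p.Prime],
      W.HasCM → CMRamified W p → 5 ≤ p → W.analyticRank = 1 →
      ∀ (f : ℕ) [NeZero f] (ψ : DirichletCharacter ℚ_[p] f) (ω : DirichletCharacter ℚ_[p] p),
        ψ.Odd → IsTeichmullerCharacter ω →
        (∀ ℓ : ℕ, ℓ.Prime → ¬ (ℓ ∣ p * W.conductorNorm ℤ) →
          ‖((W.LFunction ℓ : ℤ) : ℚ_[p]) - (ψ (ℓ : ZMod f) + ψ⁻¹ (ℓ : ZMod f) * ω (ℓ : ZMod p))‖ < 1) →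
        ‖bernoulliOnePrim ψ⁻¹‖ ≤ (p : ℝ)⁻¹ →
        (∀ s ∈ W.sha, p • s = 0 → s = 0) →
        ∀ (N : ℕ) [NeZero N] (K : Type) [Field K] [NumberField K]
          (Dt : ModularParametrizationData W N) (H : HeegnerDatum N (NumberField.discr K)) (ι : K →+* ℂ)
          (P : (W.baseChange K).toAffine.Point) (Wd : WeierstrassCurve ℚ) [Wd.IsElliptic] [Wd.IsGloballyMinimal],
          W.conductorNorm ℤ = N → IsImaginaryQuadratic K → SatisfiesHeegnerHypothesis N K →
          Odd (NumberField.discr K) → NumberField.discr K < -4 →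
          (W.quadraticTwist (NumberField.discr K : ℚ)).entireLFunction 1 ≠ 0 →
          WeierstrassCurve.Affine.Point.map ι.toRatAlgHom P = heegnerPointComplex Dt H →
          (∃ C : VariableChange ℚ, C • W.quadraticTwist (NumberField.discr K : ℚ) = Wd) →
          (∀ s ∈ Wd.sha, p • s = 0 → s = 0) →
          padicValNat p (AddSubgroup.zmultiples P).index = padicValNat p Dt.c.natAbs) :
    Summit.BirchSwinnertonDyer.BirchSwinnertonDyer.Theses.PrintCFram.BottomClassIndexLawFiveLe := by
  obtain ⟨hGZ, hKo, hGZK, hmod, -, -, hGZ73, -, -, hHP⟩ := hprints4.2.2.1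
  exact EisensteinEndStateV19.bottomClassIndexLawFiveLe_of_prints4_of_krizLi_of_classFactor_of_cover hprints4 hKL
    (ParitySplit.stubB1_of_sha_of_heegnerIndexOffLocus_of_twistSupplyOffLocus hGZ hKo hGZK hmod hGZ73 hHP hprints4.2.2.2 hSha hPrimB1
      hSupB1) hC

/-! ## §2 Registry v20's hardest stub B1-level from the Kolyvagin pair -/

/-- **B1-level ⟸ B1-sha ∧ B1-prim|_{B1} ∧ C♭|_{B1}** (granted Gross–Zagier I.(6.3), Kolyvagin, GZK, modularity, Gross–Zagier I.(7.3), the Heegner-point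
supply, Burungale–Flach Cor. 2 — MAZUR–WILES-FREE, KRIZ–LI-FREE). B1-level (LEAD g11's `hLevel`, = registry v20's `stub_bsdp_of_level`: `BSD_p` for every
rank-one class member whose generator is `p`-divisible in `W(ℚ_p)`) follows from B1 (`ParitySplit.stubB1_of_sha_of_heegnerIndexOffLocus_of_twistSupplyOffLocus`)
by w6 g3's (α) half of the level dictionary (`EisensteinEndStateV19Currencies.bsdp_of_level_pos_of_stubB1`: level `≥ 1` ⟹ non-unit class factor,
Kriz–Li-free). So v20's two arithmetic stubs (B1-level, B1-sha) are implied by the Kolyvagin pair (B1-sha, B1-prim|_{B1}) plus the twist supply.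
CONDITIONAL; BSD is not proved by any of this. [cite: GrossZagier1986, I.§4, Thm. I.(6.3) and V.§2 (pp. 310–312)] [cite: Kolyvagin1990, Thm. A]
[cite: BurungaleFlach2024, Thm. 1.1 and Cor. 2] [cite: KrizLi2019, Thm. 1.20 (pp. 7–8), (29) (pp. 49–50)] -/
theorem level_of_sha_of_heegnerIndexOffLocus_of_twistSupplyOffLocus
    (hGZ : ∀ (N : ℕ) [NeZero N] (W : WeierstrassCurve ℚ) (K : Type) [Field K] [NumberField K], gross_zagier N W K)
    (hKo : ∀ (N : ℕ) [NeZero N] (W : WeierstrassCurve ℚ) (K : Type) [Field K] [NumberField K], kolyvagin N W K)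
    (hGZK : rank_eq_analyticRank_of_analyticRank_le_one) (hmod : hasEntireLFunction_rat) (hGZ73 : GrossZagier1986_thm_I_7_3)
    (hHP : ∀ (W : WeierstrassCurve ℚ) (K : Type) [Field K] [NumberField K], exists_isHeegnerPoint W K)
    (hBF : bsdTriple_of_hasCM_of_L_one_ne_zero)
    (hSha :
    ∀ (W : WeierstrassCurve ℚ) [W.IsElliptic] [W.IsGloballyMinimal] (p : ℕ) [Fact p.Prime],
      W.HasCM → CMRamified W p → 5 ≤ p → W.analyticRank = 1 →
      (∃ s ∈ W.sha, s ≠ 0 ∧ p • s = 0) → BSDp W p)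
    (hPrimB1 :
    ∀ (W : WeierstrassCurve ℚ) [W.IsElliptic] [W.IsGloballyMinimal] (p : ℕ) [Fact p.Prime],
      W.HasCM → CMRamified W p → 5 ≤ p → W.analyticRank = 1 →
      ∀ (f : ℕ) [NeZero f] (ψ : DirichletCharacter ℚ_[p] f) (ω : DirichletCharacter ℚ_[p] p),
        ψ.Odd → IsTeichmullerCharacter ω →
        (∀ ℓ : ℕ, ℓ.Prime → ¬ (ℓ ∣ p * W.conductorNorm ℤ) →
          ‖((W.LFunction ℓ : ℤ) : ℚ_[p]) - (ψ (ℓ : ZMod f) + ψ⁻¹ (ℓ : ZMod f) * ω (ℓ : ZMod p))‖ < 1) →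
        ‖bernoulliOnePrim ψ⁻¹‖ ≤ (p : ℝ)⁻¹ →
        (∀ s ∈ W.sha, p • s = 0 → s = 0) →
        ∀ (N : ℕ) [NeZero N] (K : Type) [Field K] [NumberField K]
          (Dt : ModularParametrizationData W N) (H : HeegnerDatum N (NumberField.discr K)) (ι : K →+* ℂ)
          (P : (W.baseChange K).toAffine.Point) (Wd : WeierstrassCurve ℚ) [Wd.IsElliptic] [Wd.IsGloballyMinimal],
          W.conductorNorm ℤ = N → IsImaginaryQuadratic K → SatisfiesHeegnerHypothesis N K →
          Odd (NumberField.discr K) → NumberField.discr K < -4 →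
          (W.quadraticTwist (NumberField.discr K : ℚ)).entireLFunction 1 ≠ 0 →
          WeierstrassCurve.Affine.Point.map ι.toRatAlgHom P = heegnerPointComplex Dt H →
          (∃ C : VariableChange ℚ, C • W.quadraticTwist (NumberField.discr K : ℚ) = Wd) →
          (∀ s ∈ Wd.sha, p • s = 0 → s = 0) →
          padicValNat p (AddSubgroup.zmultiples P).index = padicValNat p Dt.c.natAbs)
    (hSupB1 :
    ∀ (W : WeierstrassCurve ℚ) [W.IsElliptic] [W.IsGloballyMinimal] (p : ℕ) [Fact p.Prime],
      W.HasCM → CMRamified W p → 5 ≤ p → W.analyticRank = 1 →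
      ∀ (f : ℕ) [NeZero f] (ψ : DirichletCharacter ℚ_[p] f) (ω : DirichletCharacter ℚ_[p] p),
        ψ.Odd → IsTeichmullerCharacter ω →
        (∀ ℓ : ℕ, ℓ.Prime → ¬ (ℓ ∣ p * W.conductorNorm ℤ) →
          ‖((W.LFunction ℓ : ℤ) : ℚ_[p]) - (ψ (ℓ : ZMod f) + ψ⁻¹ (ℓ : ZMod f) * ω (ℓ : ZMod p))‖ < 1) →
        ‖bernoulliOnePrim ψ⁻¹‖ ≤ (p : ℝ)⁻¹ →
        (∀ s ∈ W.sha, p • s = 0 → s = 0) →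
        ∃ (K : Type) (_ : Field K) (_ : NumberField K),
          IsImaginaryQuadratic K ∧ SatisfiesHeegnerHypothesis (W.conductorNorm ℤ) K ∧ Odd (NumberField.discr K) ∧
          NumberField.discr K < -4 ∧ (W.quadraticTwist (NumberField.discr K : ℚ)).entireLFunction 1 ≠ 0 ∧
          ∃ (Wd : WeierstrassCurve ℚ) (_ : Wd.IsElliptic) (_ : Wd.IsGloballyMinimal),
            (∃ C : VariableChange ℚ, C • W.quadraticTwist (NumberField.discr K : ℚ) = Wd) ∧
            ∀ s ∈ Wd.sha, p • s = 0 → s = 0) :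
    ∀ (W : WeierstrassCurve ℚ) [W.IsElliptic] [W.IsGloballyMinimal] (p : ℕ) [Fact p.Prime],
      W.HasCM → CMRamified W p → 5 ≤ p → W.analyticRank = 1 →
      ∀ P : W.toAffine.Point, ¬ IsOfFinAddOrder P →
        (∀ R : W.toAffine.Point, ∃ (k : ℤ) (T : W.toAffine.Point), IsOfFinAddOrder T ∧ R = k • P + T) →
        (∃ Q : (W.baseChange ℚ_[p]).toAffine.Point, p • Q = W.toPadicPoint p P) →
        BSDp W p :=
  fun W _ _ p _ hCM hram h5 hr P hPtor hgen hlev ↦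
    EisensteinEndStateV19Currencies.bsdp_of_level_pos_of_stubB1
      (ParitySplit.stubB1_of_sha_of_heegnerIndexOffLocus_of_twistSupplyOffLocus hGZ hKo hGZK hmod hGZ73 hHP hBF hSha hPrimB1 hSupB1)
      W p hCM hram h5 hr P hPtor hgen hlev

end Summit.BirchSwinnertonDyer.BirchSwinnertonDyer.Theorems.PrintCFram.EisensteinEndStateV19Primitivity

end
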